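import Summits.KontsevichZagierPeriods.KontsevichZagierPeriods.Theorems.SymplecticScissorsRealOnePeriodRelationsStubFormReductionPAux3
import Mathlib.LinearAlgebra.Lagrange

/-!
# Crux `RealOnePeriodRelations` (stmt-KontsevichZagierPeriods-10042), line `nash-retraction-thin-strip`, reshape 10:
# de Rham reduction on `C_T` (stub `stub_formReductionP`), IV: partial fractions in `x` and `w = 1/∏(x − b)`

Fourth of five files proving `stub_formReductionP`.  `PFrac[L, T]` is the smallest set of polynomials containing
the `xⁿ` and the `u_b^m` (`b ∈ T`) and closed under sums, algebraic scalars and congruence on `C_T` between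
polynomials over `ℚ̄`; for its members `P θ₀^C` and `P dx` are reducible (files II, III).  It is stable under
multiplication by `x` (`x u_b = 1 + b u_b`), by `w` (Lagrange: `w = Σ_b λ_b u_b`, `λ_b = ∏_{c≠b}(b − c)⁻¹`,
`eval_X_two_eq_sum`; `xⁿ u_b = Σ_{l<n} b^{n−1−l} x^l + bⁿ u_b`; `u_b u_c = (u_b − u_c)/(b − c)`) and by `f(x)`, so it
contains every `xⁱ wᵏ f(x)^m`.
[cite: HuberWustholz2022, §3.3.1, §13.2]
-/

noncomputable section

open scoped BigOperators Topology PeriodPair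
open Set Filter MvPolynomial Complex
open Literature.NumberTheory.Transcendental Literature.NumberTheory.Transcendental.CurvePeriods
open Literature.NumberTheory.Transcendental.CurvePeriods.Ell

namespace Summit.KontsevichZagierPeriods.SymplecticScissors.RealOnePeriodRelations

namespace TorsionLayer

variable {L : PeriodPair} {T : Finset ℂ}

set_option quotPrecheck false in
/-- `FRed[L, T] ω`: the polynomial 1-form `ω` on `C_T` is `a θ₀ + b θ₁ + Σ e_t dx/(x − t) + Σ o_t ξ_t + dF + ν`
with algebraic data and `ν` over `ℚ̄` vanishing on `C_T` (the conclusion of `stub_formReductionP`). -/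
local notation3 (prettyPrint := false) "FRed[" L' ", " T' "] " ω:arg =>
  (∃ (a b : ℂ) (e o : ℂ → ℂ) (F : MvPolynomial (Fin 3) ℂ) (ν : Fin 3 → MvPolynomial (Fin 3) ℂ),
    IsAlgebraic ℚ a ∧ IsAlgebraic ℚ b ∧ (∀ t ∈ T', IsAlgebraic ℚ (e t)) ∧ (∀ t ∈ T', IsAlgebraic ℚ (o t)) ∧
    HasAlgCoeffs F ∧ (∀ i, HasAlgCoeffs (ν i)) ∧ VanishesOn (curveP L' T') ν ∧
    ω = a • Theta0 L' + b • Theta1 L' + ∑ t ∈ T', e t • dlogV T' t + ∑ t ∈ T', o t • Xi L' T' t + formD F + ν)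

/-! ## Partial fractions in `x` and `w = 1/∏(x − b)` on `C_T` -/

section PFrac

/-- **The partial-fraction span** `PFrac[L, T]` (local notation): the smallest set of polynomials in `x, y, w`
containing the powers `xⁿ` and `u_b^m = (invX T b)^m` (`b ∈ T`; `u_b = 1/(x − b)` on `C_T`) and closed under sums,
algebraic scalars and congruence on `C_T` between polynomials over `ℚ̄`. By partial fractions it contains every
`xⁱ wᵏ` (`X_pow_mul_X_pow_mem_pfracSet`), and every member `P` has `P θ₀^C` and `P dx` reducible. -/
local notation3 (prettyPrint := false) "PFrac[" L' ", " T' "]" =>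
  (⋂₀ {S : Set (MvPolynomial (Fin 3) ℂ) | (∀ n : ℕ, (X 0 ^ n : MvPolynomial (Fin 3) ℂ) ∈ S) ∧
    (∀ b ∈ T', ∀ m : ℕ, invX T' b ^ m ∈ S) ∧
    (∀ P Q, P ∈ S → Q ∈ S → P + Q ∈ S) ∧ (∀ (c : ℂ) (P), IsAlgebraic ℚ c → P ∈ S → C c * P ∈ S) ∧
    (∀ P P', HasAlgCoeffs P → HasAlgCoeffs P' → (∀ p ∈ (curveP L' T').points, eval p P = eval p P') →
      P' ∈ S → P ∈ S)})

/-- Induction principle of the partial-fraction span. [folklore] -/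
theorem pfracSet_subset {S : Set (MvPolynomial (Fin 3) ℂ)} (hX : ∀ n : ℕ, (X 0 ^ n : MvPolynomial (Fin 3) ℂ) ∈ S)
    (hU : ∀ b ∈ T, ∀ m : ℕ, invX T b ^ m ∈ S) (hadd : ∀ P Q, P ∈ S → Q ∈ S → P + Q ∈ S)
    (hC : ∀ (c : ℂ) (P), IsAlgebraic ℚ c → P ∈ S → C c * P ∈ S)
    (hcongr : ∀ P P', HasAlgCoeffs P → HasAlgCoeffs P' → (∀ p ∈ (curveP L T).points, eval p P = eval p P') →
      P' ∈ S → P ∈ S) :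
    PFrac[L, T] ⊆ S := fun _ hP => Set.mem_sInter.1 hP S ⟨hX, hU, hadd, hC, hcongr⟩

/-- [folklore] -/
theorem X_pow_mem_pfracSet (n : ℕ) : (X 0 ^ n : MvPolynomial (Fin 3) ℂ) ∈ PFrac[L, T] :=
  Set.mem_sInter.2 fun _ hS => hS.1 n

/-- [folklore] -/
theorem invX_pow_mem_pfracSet {b : ℂ} (hb : b ∈ T) (m : ℕ) : invX T b ^ m ∈ PFrac[L, T] :=
  Set.mem_sInter.2 fun _ hS => hS.2.1 b hb m

/-- [folklore] -/
theorem add_mem_pfracSet {P Q : MvPolynomial (Fin 3) ℂ} (hP : P ∈ PFrac[L, T]) (hQ : Q ∈ PFrac[L, T]) :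
    P + Q ∈ PFrac[L, T] :=
  Set.mem_sInter.2 fun S hS => hS.2.2.1 P Q (Set.mem_sInter.1 hP S hS) (Set.mem_sInter.1 hQ S hS)

/-- [folklore] -/
theorem C_mul_mem_pfracSet {c : ℂ} (hc : IsAlgebraic ℚ c) {P : MvPolynomial (Fin 3) ℂ} (hP : P ∈ PFrac[L, T]) :
    C c * P ∈ PFrac[L, T] :=
  Set.mem_sInter.2 fun S hS => hS.2.2.2.1 c P hc (Set.mem_sInter.1 hP S hS)

/-- [folklore] -/
theorem congr_mem_pfracSet {P P' : MvPolynomial (Fin 3) ℂ} (hP : HasAlgCoeffs P) (hP' : HasAlgCoeffs P')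
    (heq : ∀ p ∈ (curveP L T).points, eval p P = eval p P') (h : P' ∈ PFrac[L, T]) : P ∈ PFrac[L, T] :=
  Set.mem_sInter.2 fun S hS => hS.2.2.2.2 P P' hP hP' heq (Set.mem_sInter.1 h S hS)

/-- [folklore] -/
theorem one_mem_pfracSet : (1 : MvPolynomial (Fin 3) ℂ) ∈ PFrac[L, T] := by
  simpa using X_pow_mem_pfracSet (L := L) (T := T) 0

/-- [folklore] -/
theorem zero_mem_pfracSet : (0 : MvPolynomial (Fin 3) ℂ) ∈ PFrac[L, T] := by
  simpa using C_mul_mem_pfracSet isAlgebraic_zero (one_mem_pfracSet (L := L) (T := T))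

/-- [folklore] -/
theorem C_mem_pfracSet {c : ℂ} (hc : IsAlgebraic ℚ c) : (C c : MvPolynomial (Fin 3) ℂ) ∈ PFrac[L, T] := by
  simpa using C_mul_mem_pfracSet hc (one_mem_pfracSet (L := L) (T := T))

/-- [folklore] -/
theorem sub_mem_pfracSet {P Q : MvPolynomial (Fin 3) ℂ} (hP : P ∈ PFrac[L, T]) (hQ : Q ∈ PFrac[L, T]) :
    P - Q ∈ PFrac[L, T] := by
  have e : P - Q = P + C (-1) * Q := by rw [map_neg, map_one]; ring
  rw [e]
  exact add_mem_pfracSet hP (C_mul_mem_pfracSet isAlgebraic_one.neg hQ)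

/-- [folklore] -/
theorem sum_mem_pfracSet {ι : Type*} (S : Finset ι) (f : ι → MvPolynomial (Fin 3) ℂ)
    (h : ∀ i ∈ S, f i ∈ PFrac[L, T]) : ∑ i ∈ S, f i ∈ PFrac[L, T] := by
  classical
  induction S using Finset.induction_on with
  | empty => simpa using zero_mem_pfracSet (L := L) (T := T)
  | insert j S hj ih =>
    rw [Finset.sum_insert hj]
    exact add_mem_pfracSet (h j (Finset.mem_insert_self j S)) (ih fun i hi => h i (Finset.mem_insert_of_mem hi))

/-- Members of the partial-fraction span are over `ℚ̄`. [folklore] -/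
theorem hasAlgCoeffs_of_mem_pfracSet (hT : ∀ b ∈ T, IsAlgebraic ℚ b) {P : MvPolynomial (Fin 3) ℂ}
    (hP : P ∈ PFrac[L, T]) : HasAlgCoeffs P := by
  refine pfracSet_subset (S := {P | HasAlgCoeffs P}) (fun n => (hasAlgCoeffs_X 0).pow n)
    (fun b _ m => (hasAlgCoeffs_invX hT b).pow m) (fun P Q hP hQ => HasAlgCoeffs.add hP hQ)
    (fun c P hc hP => (hasAlgCoeffs_C hc).mul hP) (fun P P' hP _ _ _ => hP) hP

/-- **`P θ₀^C` is reducible for `P` in the partial-fraction span.** [folklore] -/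
theorem fred_smul_Theta0_of_mem_pfracSet (h₂ : IsAlgebraic ℚ L.g₂) (h₃ : IsAlgebraic ℚ L.g₃)
    (hT : ∀ b ∈ T, IsAlgebraic ℚ b) {P : MvPolynomial (Fin 3) ℂ} (hP : P ∈ PFrac[L, T]) :
    FRed[L, T] (P • Theta0 L) := by
  refine (pfracSet_subset (L := L) (T := T) (S := {P | HasAlgCoeffs P ∧ FRed[L, T] (P • Theta0 L)})
    (fun n => ⟨(hasAlgCoeffs_X 0).pow n, fred_X_pow_smul_Theta0 h₂ h₃ n⟩)
    (fun b hb m => ⟨(hasAlgCoeffs_invX hT b).pow m, fred_invX_pow_smul_Theta0 L T h₂ h₃ hT b hb m⟩)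
    (fun P Q hP hQ => ⟨hP.1.add hQ.1, by rw [add_smul]; exact fred_add hP.2 hQ.2⟩)
    (fun c P hc hP => ⟨(hasAlgCoeffs_C hc).mul hP.1, by rw [C_mul_smul_form]; exact fred_smul hc hP.2⟩)
    (fun P P' hP hP' heq h => ⟨hP, fred_smul_Theta0_congr h₂ h₃ hP hP' heq h.2⟩) hP).2

/-- **`P dx` is reducible for `P` in the partial-fraction span.** [folklore] -/
theorem fred_dx_of_mem_pfracSet (h₂ : IsAlgebraic ℚ L.g₂) (h₃ : IsAlgebraic ℚ L.g₃)
    (hT : ∀ b ∈ T, IsAlgebraic ℚ b) {P : MvPolynomial (Fin 3) ℂ} (hP : P ∈ PFrac[L, T]) :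
    FRed[L, T] (![P, 0, 0] : Fin 3 → MvPolynomial (Fin 3) ℂ) := by
  have hadd : ∀ P Q : MvPolynomial (Fin 3) ℂ, (![P + Q, 0, 0] : Fin 3 → MvPolynomial (Fin 3) ℂ) =
      (![P, 0, 0] : Fin 3 → MvPolynomial (Fin 3) ℂ) + ![Q, 0, 0] := fun P Q => by
    rw [funext_iff, Fin.forall_fin_succ, Fin.forall_fin_two, Fin.succ_zero_eq_one, Fin.succ_one_eq_two]
    simp
  have hsmul : ∀ (c : ℂ) (P : MvPolynomial (Fin 3) ℂ), (![C c * P, 0, 0] : Fin 3 → MvPolynomial (Fin 3) ℂ) =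
      c • (![P, 0, 0] : Fin 3 → MvPolynomial (Fin 3) ℂ) := fun c P => by
    rw [funext_iff, Fin.forall_fin_succ, Fin.forall_fin_two, Fin.succ_zero_eq_one, Fin.succ_one_eq_two]
    simp [smul_eq_C_mul]
  refine (pfracSet_subset (L := L) (T := T)
    (S := {P | HasAlgCoeffs P ∧ FRed[L, T] (![P, 0, 0] : Fin 3 → MvPolynomial (Fin 3) ℂ)})
    (fun n => ⟨(hasAlgCoeffs_X 0).pow n, fred_X_pow_dx h₂ h₃ n⟩)
    (fun b hb m => ⟨(hasAlgCoeffs_invX hT b).pow m, fred_invX_pow_dx h₂ h₃ hT hb m⟩)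
    (fun P Q hP hQ => ⟨hP.1.add hQ.1, by rw [hadd]; exact fred_add hP.2 hQ.2⟩)
    (fun c P hc hP => ⟨(hasAlgCoeffs_C hc).mul hP.1, by rw [hsmul]; exact fred_smul hc hP.2⟩)
    (fun P P' hP hP' heq h => ⟨hP, fred_dx_congr hP hP' heq h.2⟩) hP).2

/-- The span is stable under multiplication by `x` (`x u_b = 1 + b u_b`). [folklore] -/
theorem mul_X_zero_mem_pfracSet (hT : ∀ b ∈ T, IsAlgebraic ℚ b) {P : MvPolynomial (Fin 3) ℂ}
    (hP : P ∈ PFrac[L, T]) : P * X 0 ∈ PFrac[L, T] := by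
  refine pfracSet_subset (L := L) (T := T) (S := {P | P * X 0 ∈ PFrac[L, T]}) (fun n => ?_) (fun b hb m => ?_)
    (fun P Q hP hQ => ?_) (fun c P hc hP => ?_) (fun P P' hP hP' heq h => ?_) hP
  · show X 0 ^ n * X 0 ∈ PFrac[L, T]
    rw [← pow_succ]
    exact X_pow_mem_pfracSet _
  · show invX T b ^ m * X 0 ∈ PFrac[L, T]
    rcases m with _ | m
    · simpa using X_pow_mem_pfracSet (L := L) (T := T) 1
    · have hu := hasAlgCoeffs_invX hT b
      refine congr_mem_pfracSet ((hu.pow _).mul (hasAlgCoeffs_X 0)) ((hu.pow m).add ((hasAlgCoeffs_C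
        (hT b hb)).mul (hu.pow _))) (fun p hp => ?_) (add_mem_pfracSet (invX_pow_mem_pfracSet hb m)
        (C_mul_mem_pfracSet (hT b hb) (invX_pow_mem_pfracSet hb (m + 1))))
      have hU := eval_invX_mul_sub hb hp
      simp only [map_mul, map_add, map_pow, eval_X, eval_C]
      linear_combination (eval p (invX T b) ^ m) * hU
  · show (P + Q) * X 0 ∈ PFrac[L, T]
    rw [add_mul]
    exact add_mem_pfracSet hP hQ
  · show C c * P * X 0 ∈ PFrac[L, T]
    rw [mul_assoc]
    exact C_mul_mem_pfracSet hc hP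
  · show P * X 0 ∈ PFrac[L, T]
    exact congr_mem_pfracSet (hP.mul (hasAlgCoeffs_X 0)) (hP'.mul (hasAlgCoeffs_X 0))
      (fun p hp => by rw [map_mul, map_mul, heq p hp]) h

/-- **Lagrange**: `w = Σ_{b∈T} λ_b u_b` with `λ_b = ∏_{c≠b}(b − c)⁻¹` (partial fractions of `1/∏(x − b)`), as an identity of
the polynomial representatives at every point. [folklore] -/
theorem eval_X_two_eq_sum : ∀ (T : Finset ℂ), T.Nonempty → ∀ (p : Fin 3 → ℂ), p 2 = ∑ b ∈ T, (∏ c ∈ T.erase b, (b - c)⁻¹) * eval p (invX T b) := by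
  intro T hne p
  classical
  have h := Lagrange.sum_basis (v := id) (s := T) (Set.injOn_id _) hne
  have h' := congrArg (Polynomial.eval (p 0)) h
  rw [Polynomial.eval_finsetSum, Polynomial.eval_one] at h'
  have hb : ∀ b ∈ T, Polynomial.eval (p 0) (Lagrange.basis T id b) =
      (∏ c ∈ T.erase b, (b - c)⁻¹) * ∏ c ∈ T.erase b, (p 0 - c) := by
    intro b _
    rw [Lagrange.basis, Polynomial.eval_prod, ← Finset.prod_mul_distrib]
    refine Finset.prod_congr rfl fun c _ => ?_
    simp [Lagrange.basisDivisor]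
  calc p 2 = p 2 * ∑ b ∈ T, Polynomial.eval (p 0) (Lagrange.basis T id b) := by rw [h', mul_one]
    _ = ∑ b ∈ T, (∏ c ∈ T.erase b, (b - c)⁻¹) * eval p (invX T b) := by
      rw [Finset.mul_sum]
      refine Finset.sum_congr rfl fun b hb' => ?_
      rw [hb b hb', eval_invX, eval_cofP]
      ring

/-- `λ_b ∈ ℚ̄`. [folklore] -/
theorem isAlgebraic_lagrangeCoeff (hT : ∀ b ∈ T, IsAlgebraic ℚ b) {b : ℂ} (hb : b ∈ T) :
    IsAlgebraic ℚ (∏ c ∈ T.erase b, (b - c)⁻¹) :=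
  Finset.prod_induction _ (IsAlgebraic ℚ) (fun _ _ h h' => h.mul h') isAlgebraic_one
    fun c hc => ((hT b hb).sub (hT c (Finset.mem_of_mem_erase hc))).inv

/-- `u_b^m u_c` lies in the span (`b, c ∈ T`): `u_b u_c = (u_b − u_c)/(b − c)` for `b ≠ c`. [folklore] -/
theorem invX_pow_mul_invX_mem_pfracSet (hT : ∀ b ∈ T, IsAlgebraic ℚ b) {b c : ℂ} (hb : b ∈ T) (hc : c ∈ T) :
    ∀ m : ℕ, invX T b ^ m * invX T c ∈ PFrac[L, T] := by
  by_cases hbc : b = c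
  · subst hbc
    intro m
    rw [← pow_succ]
    exact invX_pow_mem_pfracSet hb _
  have hbc' : b - c ≠ 0 := sub_ne_zero.2 hbc
  have hu := hasAlgCoeffs_invX hT b
  have hv := hasAlgCoeffs_invX hT c
  intro m
  induction m with
  | zero => simpa using invX_pow_mem_pfracSet (L := L) hc 1
  | succ m ih =>
    refine congr_mem_pfracSet ((hu.pow _).mul hv) ((hasAlgCoeffs_C ((hT b hb).sub (hT c hc)).inv).mul
      ((hu.pow _).sub ((hu.pow _).mul hv))) (fun p hp => ?_)
      (C_mul_mem_pfracSet ((hT b hb).sub (hT c hc)).inv (sub_mem_pfracSet (invX_pow_mem_pfracSet hb (m + 1)) ih))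
    have hU := eval_invX_mul_sub hb hp
    have hV := eval_invX_mul_sub hc hp
    simp only [map_mul, map_sub, map_pow, eval_C]
    rw [eq_comm, inv_mul_eq_iff_eq_mul₀ hbc']
    linear_combination (-(eval p (invX T b) ^ m * eval p (invX T b))) * hV +
      (eval p (invX T b) ^ m * eval p (invX T c)) * hU

/-- The span is stable under multiplication by `w` (`w = Σ λ_b u_b`, `xⁿ u_b = Σ_{l<n} b^{n−1−l} x^l + bⁿ u_b`,
`u_b^m u_c` as above). [folklore] -/
theorem mul_X_two_mem_pfracSet (hT : ∀ b ∈ T, IsAlgebraic ℚ b) {P : MvPolynomial (Fin 3) ℂ}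
    (hP : P ∈ PFrac[L, T]) : P * X 2 ∈ PFrac[L, T] := by
  classical
  refine pfracSet_subset (L := L) (T := T) (S := {P | P * X 2 ∈ PFrac[L, T]}) (fun n => ?_) (fun b hb m => ?_)
    (fun P Q hP hQ => ?_) (fun c P hc hP => ?_) (fun P P' hP hP' heq h => ?_) hP
  · show X 0 ^ n * X 2 ∈ PFrac[L, T]
    rcases T.eq_empty_or_nonempty with hTe | hne
    · -- `T = ∅`: `w = 1` on `C_T`
      refine congr_mem_pfracSet (((hasAlgCoeffs_X 0).pow n).mul (hasAlgCoeffs_X 2)) ((hasAlgCoeffs_X 0).pow n)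
        (fun p hp => ?_) (X_pow_mem_pfracSet n)
      have hw := ((mem_points_curveP_iff L T p).1 hp).2
      rw [hTe, Finset.prod_empty, mul_one] at hw
      simp [hw]
    · have hlam : ∀ {b : ℂ}, b ∈ T → IsAlgebraic ℚ (∏ c ∈ T.erase b, (b - c)⁻¹) := fun hb =>
        isAlgebraic_lagrangeCoeff hT hb
      refine congr_mem_pfracSet (((hasAlgCoeffs_X 0).pow n).mul (hasAlgCoeffs_X 2)) ?_ (fun p hp => ?_)
        (sum_mem_pfracSet T (fun b => C (∏ c ∈ T.erase b, (b - c)⁻¹) *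
          (∑ l ∈ Finset.range n, C (b ^ (n - 1 - l)) * X 0 ^ l + C (b ^ n) * invX T b)) fun b hb =>
          C_mul_mem_pfracSet (hlam hb) (add_mem_pfracSet (sum_mem_pfracSet _ _ fun l _ =>
            C_mul_mem_pfracSet ((hT b hb).pow _) (X_pow_mem_pfracSet l))
            (C_mul_mem_pfracSet ((hT b hb).pow n) (by simpa using invX_pow_mem_pfracSet (L := L) hb 1))))
      · exact hasAlgCoeffs_finsetSum _ _ fun b hb => (hasAlgCoeffs_C (hlam hb)).mul
          ((hasAlgCoeffs_finsetSum _ _ fun l _ => (hasAlgCoeffs_C ((hT b hb).pow _)).mul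
            ((hasAlgCoeffs_X 0).pow l)).add ((hasAlgCoeffs_C ((hT b hb).pow n)).mul (hasAlgCoeffs_invX hT b)))
      · rw [map_mul, map_pow, eval_X, eval_X, eval_X_two_eq_sum T hne p, Finset.mul_sum, map_sum]
        refine Finset.sum_congr rfl fun b hb => ?_
        have hU := eval_invX_mul_sub hb hp
        have hg := geom_sum₂_mul (p 0) b n
        have hG : ∑ x ∈ Finset.range n, b ^ (n - 1 - x) * p 0 ^ x =
            ∑ x ∈ Finset.range n, p 0 ^ x * b ^ (n - 1 - x) :=
          Finset.sum_congr rfl fun x _ => mul_comm _ _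
        simp only [map_mul, map_add, map_sum, map_pow, eval_C, eval_X]
        rw [hG]
        linear_combination (∏ c ∈ T.erase b, (b - c)⁻¹) * ((-(eval p (invX T b))) * hg +
          (∑ x ∈ Finset.range n, p 0 ^ x * b ^ (n - 1 - x)) * hU)
  · show invX T b ^ m * X 2 ∈ PFrac[L, T]
    have hne : T.Nonempty := ⟨b, hb⟩
    have hlam : ∀ {b : ℂ}, b ∈ T → IsAlgebraic ℚ (∏ c ∈ T.erase b, (b - c)⁻¹) := fun hb =>
      isAlgebraic_lagrangeCoeff hT hb
    have hu := hasAlgCoeffs_invX hT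
    refine congr_mem_pfracSet (((hu b).pow m).mul (hasAlgCoeffs_X 2)) ?_ (fun p hp => ?_)
      (sum_mem_pfracSet T (fun c => C (∏ d ∈ T.erase c, (c - d)⁻¹) * (invX T b ^ m * invX T c)) fun c hc =>
        C_mul_mem_pfracSet (hlam hc) (invX_pow_mul_invX_mem_pfracSet hT hb hc m))
    · exact hasAlgCoeffs_finsetSum _ _ fun c hc => (hasAlgCoeffs_C (hlam hc)).mul (((hu b).pow m).mul (hu c))
    · rw [map_mul, map_pow, eval_X, eval_X_two_eq_sum T hne p, Finset.mul_sum, map_sum]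
      refine Finset.sum_congr rfl fun c _ => ?_
      simp only [map_mul, map_pow, eval_C]
      ring
  · show (P + Q) * X 2 ∈ PFrac[L, T]
    rw [add_mul]
    exact add_mem_pfracSet hP hQ
  · show C c * P * X 2 ∈ PFrac[L, T]
    rw [mul_assoc]
    exact C_mul_mem_pfracSet hc hP
  · show P * X 2 ∈ PFrac[L, T]
    exact congr_mem_pfracSet (hP.mul (hasAlgCoeffs_X 2)) (hP'.mul (hasAlgCoeffs_X 2))
      (fun p hp => by rw [map_mul, map_mul, heq p hp]) h

/-- `xⁱ wᵏ` lies in the span. [folklore] -/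
theorem X_pow_mul_X_pow_mem_pfracSet (hT : ∀ b ∈ T, IsAlgebraic ℚ b) (i : ℕ) :
    ∀ k : ℕ, (X 0 ^ i * X 2 ^ k : MvPolynomial (Fin 3) ℂ) ∈ PFrac[L, T]
  | 0 => by simpa using X_pow_mem_pfracSet (L := L) (T := T) i
  | k + 1 => by
    rw [pow_succ, ← mul_assoc]
    exact mul_X_two_mem_pfracSet hT (X_pow_mul_X_pow_mem_pfracSet hT i k)

/-- The span is stable under multiplication by `f(x)`. [folklore] -/
theorem mul_fPoly3_mem_pfracSet (h₂ : IsAlgebraic ℚ L.g₂) (h₃ : IsAlgebraic ℚ L.g₃) (hT : ∀ b ∈ T, IsAlgebraic ℚ b)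
    {P : MvPolynomial (Fin 3) ℂ} (hP : P ∈ PFrac[L, T]) : P * fPoly3 L ∈ PFrac[L, T] := by
  have e : P * fPoly3 L = P * X 0 * X 0 * X 0 + C (A L) * (P * X 0) + C (B L) * P := by
    rw [fPoly3]
    ring
  rw [e]
  exact add_mem_pfracSet (add_mem_pfracSet (mul_X_zero_mem_pfracSet hT (mul_X_zero_mem_pfracSet hT
    (mul_X_zero_mem_pfracSet hT hP))) (C_mul_mem_pfracSet (isAlgebraic_A L h₂) (mul_X_zero_mem_pfracSet hT hP)))
    (C_mul_mem_pfracSet (isAlgebraic_B L h₃) hP)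

/-- `xⁱ wᵏ f(x)^m` lies in the span. [folklore] -/
theorem X_pow_mul_X_pow_mul_fPoly3_pow_mem_pfracSet (h₂ : IsAlgebraic ℚ L.g₂) (h₃ : IsAlgebraic ℚ L.g₃)
    (hT : ∀ b ∈ T, IsAlgebraic ℚ b) (i k : ℕ) :
    ∀ m : ℕ, (X 0 ^ i * X 2 ^ k * fPoly3 L ^ m : MvPolynomial (Fin 3) ℂ) ∈ PFrac[L, T]
  | 0 => by simpa using X_pow_mul_X_pow_mem_pfracSet (L := L) hT i k
  | m + 1 => by
    rw [pow_succ, ← mul_assoc]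
    exact mul_fPoly3_mem_pfracSet h₂ h₃ hT (X_pow_mul_X_pow_mul_fPoly3_pow_mem_pfracSet h₂ h₃ hT i k m)

end PFrac


end TorsionLayer

end Summit.KontsevichZagierPeriods.SymplecticScissors.RealOnePeriodRelations

end
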